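import Summits.QuantumFields.BalabanUV.Beta.EriceRemainderEnclosureHistoryAutonomyComparisonAgeCompositionGeometricCoverFlow
import Summits.QuantumFields.BalabanUV.Beta.EriceRemainderEnclosureHistoryAutonomyComparisonAgeCompositionGeometricCoverTiers

/-!
# EriceRemainderEnclosureHistoryAutonomyComparisonAgeCompositionGeometricCoverTiersFlow — (E114g) route (N), first order: THE TWO-CONSTANT COVER ALONG THE
# UNDAMPED FLOW.  (E114d) instantiates (E114c) with the single concavity constant `r = √2∕4`; (E114f) allows a second constant `s` for the SHALLOW equations
# (`j < l₀`) on the OLD columns (`l ≥ l₁`).  Along a box solution of an isotone memory with floor, for `j < l₀ ≤ l₁ ≤ l < k`: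
#     `a_{m+k+1+j} ≤ ((m+k+1+j)∕(m+k))·a_{m+k} ≤ a_{m+k}∕q`   whenever `q·(l₁+1+l₀) ≤ l₁+1`
# ((E58b) `mul_invSq_add_le`), i.e. `h(m+k+1+j)³ ≥ q√q·h(m+k)³` (**`cube_dominated_ratio`**), hence `q√q·KA 1 m l ≤ KA 1 (m+1+j) (l−1−j)` for the undamped aggregate
# kernel (**`aggregate_dominated_undamped_ratio`**) — e.g. `l₁ + 1 = 7(l₀ … )`: `q = 7∕8`, `s = q√q = 0.818`.  With (E114f) `sol_nonneg_le_of_two_constant_cover`: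
# **`flow_nonneg_of_two_constant_cover_undamped`** — the END (undamped, any profile, any range, any horizon) under the displayed product criterion
#     `c_m ≥ 0` and `Λ¹_m + c_m·(1 − Q_m)∕r ≤ 1` at every pin,
# `P_m(l) = Π_{i<l}(1 − r·KA 1 m i)`, `Λ⁰_m = (1 − P_m(l₀))∕r`, `Λ¹_m = (1 − P_m(l₁))∕r`, `c_m = 1 − s·Λ⁰_m − r·(Λ¹_m − Λ⁰_m)`, `Q_m = Π_{l₁≤i<K}(1 − r·KA 1 m i)`, `r = √2∕4`,
# `s = q√q`.  READING (README `HOME/b2b-balaban-beta-d4-p2/g95/README.md` §5–§6): the young block's diagonal weights `Λ⁰ ≈ (1 − e^{−rY})∕r` cover the old columns with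
# `s ≈ 0.82` instead of `0.35`; for the old-only frontier (`Y ≈ 0.34`, old entries `≤ F ≈ 0.02`) the criterion reads `≈ 0.33 + 0.73·(1 − e^{−0.356·T_old})∕0.354 ≤ 1`,
# i.e. `T_old ≲ 1.07`, `T ≲ 1.41` (K ≈ 2^35) — against `1.18` ((E114e)) and `1` (light load); the LP-optimal cover (README §5) is the envelope of all such tiers.

Cell `pub-balaban`, β-function sub-cell, BINDER row D4 «RemainderConst leaves for Bałaban's split» (`HOME/BINDER-OWNERS.md`; owner lineage `b2b-balaban-beta-an4`;
this file by co-owner #2 lineage `b2b-balaban-beta-d4-p2`, generation 95), β-FLOW TEAM duty (1), FREEZE (0) honoured (def-free; imports (E114d), (E114f); uses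
(E114f) `sol_nonneg_le_of_two_constant_cover`, (E114d) `aggregate_dominated_undamped`, (E113d) `aggregate_one_eq`, (E80a) `weight_nonneg`, (E86a) `sum_range_of_le` ∕
`aggregate_eq_zero_of_horizon`, (E58b) `mul_invSq_add_le` BY NAME; the display of `KL`, `KA`, `RA` is (E86i)'s VERBATIM; nothing restated).

HONEST FRAMING (page 1, verbatim and binding).  *"Discharging BetaPertH makes Bałaban's UV stability UNCONDITIONAL — a real constructive-QFT result; it is
NOT the continuum limit and NOT the Clay problem."*  THIS FILE DISCHARGES NOTHING OF THE KIND.  Elementary real analysis about ABSTRACT functionals on a box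
]0,γ]^ℕ with displayed floors, profiles and signs, and the FIRST-ORDER renewal objects of route (N) built from them — hypotheses of a census, not facts; the
form, signs, ages and moments of Bałaban's (1.22) limit functional are NOT PRINTED ([I] p. 298; GAPS G-t4-U2-1∕-2) and NOT asserted.  Row D4 class
UNCHANGED (critical-path width 0; instance 0∕1; D4 DISCHARGE NO DATE).  HONEST DEPENDENCY: continuum YM on T⁴ ⇐ BetaPertH ∧ nine spine estimates (0/9
proved); BetaPertH ⇐ (D1) ∧ (D4) ∧ CAP+tail; G-an2-4 gates asym, D1 and NE2/3/4.

NOT CLAIMED: the criterion along every admissible flow for every profile (finite-range: README §4–§5); the damped system; the census-letter form of the criterion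
(successor); anything printed — NOT B12 Thm 2, NOT BetaPertH.

WHAT IS PROVED ([folklore]; 0 `def`, 0 sorry).  §1 `invSq_le_div_of_ratio`, **`cube_dominated_ratio`**.  §2 **`aggregate_dominated_undamped_ratio`**.  §3
**`flow_nonneg_of_two_constant_cover_undamped`**.
-/
noncomputable section
open Finset

namespace Summit.QuantumFields.BalabanUV.Beta.EriceRemainderEnclosureHistoryAutonomyComparisonAgeCompositionGeometricCoverTiersFlow

open Literature.MathematicalPhysics.QuantumFieldTheory.Balaban1983to89
open Literature.MathematicalPhysics.QuantumFieldTheory.Balaban1983to89.T4BetaStationary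
open Literature.MathematicalPhysics.QuantumFieldTheory.Balaban1983to89.T4BetaFlowWellPosed
open Summit.QuantumFields.BalabanUV.Beta.EriceRemainderEnclosureHistoryAutonomyComparisonAffineProfile (mul_invSq_add_le)
open Summit.QuantumFields.BalabanUV.Beta.EriceRemainderEnclosureHistoryAutonomyComparisonAgeCompositionIdentification (weight_nonneg)
open Summit.QuantumFields.BalabanUV.Beta.EriceRemainderEnclosureHistoryAutonomyComparisonAgeCompositionDecayHorizon (sum_range_of_le aggregate_eq_zero_of_horizon)
open Summit.QuantumFields.BalabanUV.Beta.EriceRemainderEnclosureHistoryAutonomyComparisonAgeCompositionNextRowAges (aggregate_one_eq)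
open Summit.QuantumFields.BalabanUV.Beta.EriceRemainderEnclosureHistoryAutonomyComparisonAgeCompositionGeometricCoverFlow (aggregate_dominated_undamped)
open Summit.QuantumFields.BalabanUV.Beta.EriceRemainderEnclosureHistoryAutonomyComparisonAgeCompositionGeometricCoverTiers (sol_nonneg_le_of_two_constant_cover)

variable {B : (ℕ → ℝ) → ℝ} {γ b gIR : ℝ} {L : ℕ → ℝ} {K : ℕ} {h g : ℕ → ℝ} {KL : ℕ → ℕ → ℕ → ℝ}

/-! ## §1 Concavity with a ratio: `a_{n+d} ≤ a_n∕q` when `q·(n+d) ≤ n` -/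

/-- **`a_{n+d} ≤ a_n∕q`** along every box solution of an isotone memory with floor, whenever `0 < q`, `1 ≤ d` and `q·(n+d) ≤ n` ((E58b) `mul_invSq_add_le`).
[folklore] -/
theorem invSq_le_div_of_ratio (hmono : ∀ u v : ℕ → ℝ, SeqBox γ u → SeqBox γ v → (∀ j, u j ≤ v j) → B u ≤ B v) (hb : 0 < b)
    (hlo : ∀ u, SeqBox γ u → b ≤ B u) (hh : SeqBox γ h) (hf : MemFlow B gIR h) {n d : ℕ} {q : ℝ} (hq0 : 0 < q) (hd : 1 ≤ d)
    (hq : q * ((n : ℝ) + d) ≤ n) : 1 / h (n + d) ^ 2 ≤ (1 / h n ^ 2) / q := by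
  have hgIR : 0 < gIR := by rw [← hf.1]; exact (hh 0).1
  have hc := mul_invSq_add_le hmono hb hlo hgIR hh hf n d
  have hd1 : (1 : ℝ) ≤ d := by exact_mod_cast hd
  have hn0 : (0 : ℝ) ≤ n := Nat.cast_nonneg n
  have hnd : (0 : ℝ) < (n : ℝ) + d := by linarith
  have hA : 0 ≤ 1 / h (n + d) ^ 2 := by have := (hh (n + d)).1; positivity
  have ha : 0 ≤ 1 / h n ^ 2 := by have := (hh n).1; positivity
  rw [le_div_iff₀ hq0]
  -- `q(n+d)·a_{n+d} ≤ n·a_{n+d} ≤ (n+d)·a_n`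
  have h1 : q * ((n : ℝ) + d) * (1 / h (n + d) ^ 2) ≤ (n : ℝ) * (1 / h (n + d) ^ 2) := mul_le_mul_of_nonneg_right hq hA
  have h3 : ((n : ℝ) + d) * (1 / h (n + d) ^ 2 * q) ≤ ((n : ℝ) + d) * (1 / h n ^ 2) := by linarith
  exact le_of_mul_le_mul_left h3 hnd

/-- **THE CUBE DOMINATION WITH A RATIO**: `q√q·h(m+k)³ ≤ h(m+k+1+j)³` whenever `0 < q` and `q·(m+k+1+j) ≤ m+k`. [folklore] -/
theorem cube_dominated_ratio (hmono : ∀ u v : ℕ → ℝ, SeqBox γ u → SeqBox γ v → (∀ j, u j ≤ v j) → B u ≤ B v) (hb : 0 < b)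
    (hlo : ∀ u, SeqBox γ u → b ≤ B u) (hh : SeqBox γ h) (hf : MemFlow B gIR h) {m k j : ℕ} {q : ℝ} (hq0 : 0 < q)
    (hq : q * ((m : ℝ) + k + 1 + j) ≤ (m : ℝ) + k) :
    q * Real.sqrt q * h (m + k) ^ 3 ≤ h (m + k + 1 + j) ^ 3 := by
  have hx := (hh (m + k)).1
  have hy := (hh (m + k + 1 + j)).1
  have ha := invSq_le_div_of_ratio hmono hb hlo hh hf (n := m + k) (d := 1 + j) hq0 (by omega) (by push_cast; linarith)
  rw [show m + k + (1 + j) = m + k + 1 + j by ring] at ha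
  -- `q·x² ≤ y²`
  have hsq : q * h (m + k) ^ 2 ≤ h (m + k + 1 + j) ^ 2 := by
    rw [le_div_iff₀ hq0] at ha
    have e1 : 1 / h (m + k + 1 + j) ^ 2 * q = q / h (m + k + 1 + j) ^ 2 := by ring
    rw [e1, div_le_div_iff₀ (by positivity) (by positivity), one_mul] at ha
    exact ha
  have hsqrt : Real.sqrt q * h (m + k) ≤ h (m + k + 1 + j) := by
    have e1 : Real.sqrt (q * h (m + k) ^ 2) = Real.sqrt q * h (m + k) := by rw [Real.sqrt_mul hq0.le, Real.sqrt_sq hx.le]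
    have e2 : Real.sqrt (h (m + k + 1 + j) ^ 2) = h (m + k + 1 + j) := Real.sqrt_sq hy.le
    rw [← e1, ← e2]; exact Real.sqrt_le_sqrt hsq
  calc q * Real.sqrt q * h (m + k) ^ 3 = (q * h (m + k) ^ 2) * (Real.sqrt q * h (m + k)) := by ring
    _ ≤ h (m + k + 1 + j) ^ 2 * h (m + k + 1 + j) := mul_le_mul hsq hsqrt (by positivity) (by positivity)
    _ = h (m + k + 1 + j) ^ 3 := by ring

/-! ## §2 Shallow equations dominate old columns up to `q√q` -/

/-- **SHALLOW EQUATIONS ON OLD COLUMNS**: `g ≡ 1`, `j < l₀`, `l₁ ≤ l`, `0 < q`, `q·(l₁+1+l₀) ≤ l₁+1` ⟹ `q√q·KA 1 m l ≤ KA 1 (m+1+j) (l−1−j)`. [folklore] -/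
theorem aggregate_dominated_undamped_ratio (hmono : ∀ u v : ℕ → ℝ, SeqBox γ u → SeqBox γ v → (∀ j, u j ≤ v j) → B u ≤ B v)
    (hL : ∀ k, 0 ≤ L k) (hb : 0 < b) (hlo : ∀ u, SeqBox γ u → b ≤ B u) (hh : SeqBox γ h) (hf : MemFlow B gIR h) (hg1 : ∀ t, g t = 1) (hK : 1 ≤ K)
    (hKL : ∀ k n l, KL k n l = if 0 < k ∧ k < K ∧ l < k then L k * h (n + k) ^ 3 / 2 * ∏ t ∈ Ico (n + 1 + l) (n + k + 1), g t else 0)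
    {KA : ℕ → ℕ → ℕ → ℝ} (hKA : ∀ i m l, KA i m l = KL i m l + KA (i + 1) m l) (hKAtop : ∀ m l, KA K m l = 0)
    {l₀ l₁ : ℕ} {q : ℝ} (hq0 : 0 < q) (hq : q * ((l₁ : ℝ) + 1 + l₀) ≤ (l₁ : ℝ) + 1)
    {m j l : ℕ} (hj : j < l₀) (hl : l₁ ≤ l) :
    q * Real.sqrt q * KA 1 m l ≤ KA 1 (m + 1 + j) (l - 1 - j) := by
  have hg : ∀ t, 0 < g t ∧ g t ≤ 1 := fun t => by rw [hg1 t]; norm_num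
  have hh0 : ∀ n, 0 < h n := fun n => (hh n).1
  have hKL0 := weight_nonneg hL hh0 hg hKL
  have hprod : ∀ a c : ℕ, ∏ t ∈ Ico a c, g t = 1 := fun a c => prod_eq_one fun t _ => hg1 t
  have hq1 : q ≤ 1 := by
    have : (0 : ℝ) ≤ l₀ := Nat.cast_nonneg l₀
    have : (0 : ℝ) ≤ l₁ := Nat.cast_nonneg l₁
    nlinarith
  rw [aggregate_one_eq hK hKA hKAtop m l, aggregate_one_eq hK hKA hKAtop (m + 1 + j) (l - 1 - j), mul_sum]
  refine sum_le_sum fun k hk => ?_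
  have hk := mem_Ico.mp hk
  by_cases hlk : l < k
  · rw [hKL k m l, if_pos ⟨hk.1, hk.2, hlk⟩, hKL k (m + 1 + j) (l - 1 - j), if_pos ⟨hk.1, hk.2, by omega⟩, hprod, hprod, mul_one, mul_one,
      show m + 1 + j + k = m + k + 1 + j by ring]
    -- `q(m+k+1+j) ≤ m+k` from `q(l₁+1+l₀) ≤ l₁+1`, `m+k ≥ l₁+1`, `j+1 ≤ l₀`
    have hratio : q * ((m : ℝ) + k + 1 + j) ≤ (m : ℝ) + k := by
      have h1 : ((l₁ : ℝ) + 1) ≤ (m : ℝ) + k := by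
        have : l₁ + 1 ≤ m + k := by omega
        exact_mod_cast this
      have h2 : ((j : ℝ) + 1) ≤ l₀ := by exact_mod_cast (show j + 1 ≤ l₀ by omega)
      -- q(m+k+1+j) ≤ q(m+k) + q l₀ and q l₀ ≤ (1−q)(l₁+1) ≤ (1−q)(m+k)
      have h3 : q * (l₀ : ℝ) ≤ (1 - q) * ((l₁ : ℝ) + 1) := by linarith
      have h4 : (1 - q) * ((l₁ : ℝ) + 1) ≤ (1 - q) * ((m : ℝ) + k) := mul_le_mul_of_nonneg_left h1 (by linarith)
      nlinarith
    have hc := cube_dominated_ratio hmono hb hlo hh hf (m := m) (k := k) (j := j) hq0 hratio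
    have := mul_le_mul_of_nonneg_left hc (show 0 ≤ L k / 2 by have := hL k; positivity)
    calc q * Real.sqrt q * (L k * h (m + k) ^ 3 / 2) = L k / 2 * (q * Real.sqrt q * h (m + k) ^ 3) := by ring
      _ ≤ L k / 2 * h (m + k + 1 + j) ^ 3 := this
      _ = L k * h (m + k + 1 + j) ^ 3 / 2 := by ring
  · rw [hKL k m l, if_neg (by omega), mul_zero]
    exact hKL0 k (m + 1 + j) (l - 1 - j)

/-! ## §3 The END by the two-constant cover along the undamped flow -/

/-- **ROUTE (N), FIRST ORDER — THE END BY THE TWO-CONSTANT GEOMETRIC COVER (UNDAMPED; ANY PROFILE, ANY RANGE, ANY HORIZON).**  `B` an isotone memory on the box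
with floor `b > 0` dominating the profile `L ≥ 0` on the ages `< K` (`K ≥ 1`); `h` a box solution; `g ≡ 1`; `KL`, `KA`, `RA` as displayed; horizon `N ≥ K`; tiers
`l₀ ≤ l₁`, a ratio `0 < q` with `q·(l₁+1+l₀) ≤ l₁+1`; `r = √2∕4`, `s = q√q`; `r·KA 1 m l < 1`.  With `P_m(l) = Π_{i<l}(1 − r·KA 1 m i)`, `c_m = 1 − s(1 − P_m(l₀))∕r −
r((1 − P_m(l₁))∕r − (1 − P_m(l₀))∕r)`: IF `0 ≤ c_m` and `(1 − P_m(l₁))∕r + c_m·(1 − Π_{l₁≤i<K}(1 − r·KA 1 m i))∕r ≤ 1` at every pin, THEN `0 ≤ ε m ≤ e m` at every pin for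
every admissible excess. [folklore] -/
theorem flow_nonneg_of_two_constant_cover_undamped (hmono : ∀ u v : ℕ → ℝ, SeqBox γ u → SeqBox γ v → (∀ j, u j ≤ v j) → B u ≤ B v)
    (hL : ∀ k, 0 ≤ L k) (hb : 0 < b) (hlo : ∀ u, SeqBox γ u → b ≤ B u) (hh : SeqBox γ h) (hf : MemFlow B gIR h) (hg1 : ∀ t, g t = 1)
    (hK : 1 ≤ K) {N : ℕ} (hKN : K ≤ N)
    (hKL : ∀ k n l, KL k n l = if 0 < k ∧ k < K ∧ l < k then L k * h (n + k) ^ 3 / 2 * ∏ t ∈ Ico (n + 1 + l) (n + k + 1), g t else 0)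
    {KA : ℕ → ℕ → ℕ → ℝ} {RA : ℕ → (ℕ → ℝ) → ℕ → ℝ}
    (hRA : ∀ i v m, RA i v m = ∑ l ∈ range K, KA i m l * v (m + 1 + l))
    (hKA : ∀ i m l, KA i m l = KL i m l + KA (i + 1) m l) (hKAtop : ∀ m l, KA K m l = 0)
    {l₀ l₁ : ℕ} (h01 : l₀ ≤ l₁) (hl₁K : l₁ ≤ K) {q : ℝ} (hq0 : 0 < q) (hq : q * ((l₁ : ℝ) + 1 + l₀) ≤ (l₁ : ℝ) + 1)
    (hrt : ∀ m l, Real.sqrt 2 / 4 * KA 1 m l < 1)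
    {c : ℕ → ℝ}
    (hc : ∀ m, c m = 1 - q * Real.sqrt q * ((1 - ∏ i ∈ range l₀, (1 - Real.sqrt 2 / 4 * KA 1 m i)) / (Real.sqrt 2 / 4))
      - Real.sqrt 2 / 4 * ((1 - ∏ i ∈ range l₁, (1 - Real.sqrt 2 / 4 * KA 1 m i)) / (Real.sqrt 2 / 4)
        - (1 - ∏ i ∈ range l₀, (1 - Real.sqrt 2 / 4 * KA 1 m i)) / (Real.sqrt 2 / 4)))
    (hc0 : ∀ m, 0 ≤ c m)
    (hcrit : ∀ m, (1 - ∏ i ∈ range l₁, (1 - Real.sqrt 2 / 4 * KA 1 m i)) / (Real.sqrt 2 / 4)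
      + c m * (1 - ∏ i ∈ Ico l₁ K, (1 - Real.sqrt 2 / 4 * KA 1 m i)) / (Real.sqrt 2 / 4) ≤ 1)
    {e ε : ℕ → ℝ} (he0 : ∀ m, 0 ≤ e m) (hea : ∀ m, e (m + 1) ≤ e m)
    (hεt : ∀ m, N < m → ε m = 0) (hεrec : ∀ m, ε m = e m - RA 1 ε m) : ∀ m, 0 ≤ ε m ∧ ε m ≤ e m := by
  have hg : ∀ t, 0 < g t ∧ g t ≤ 1 := fun t => by rw [hg1 t]; norm_num
  have hh0 : ∀ n, 0 < h n := fun n => (hh n).1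
  have hKL0 := weight_nonneg hL hh0 hg hKL
  have hKLK : ∀ i m l, K ≤ l + 1 → KL i m l = 0 := fun i m l hl => by rw [hKL, if_neg (by omega)]
  have hKLtop : ∀ i m l, K ≤ i → KL i m l = 0 := fun i m l hi => by rw [hKL, if_neg (by omega)]
  have hKA0 : ∀ i m l, K ≤ l → KA i m l = 0 :=
    aggregate_eq_zero_of_horizon hKA hKAtop (fun i m l hl => hKLK i m l (by omega)) hKLtop
  have hKA10 : ∀ m l, 0 ≤ KA 1 m l := fun m l => by
    rw [aggregate_one_eq hK hKA hKAtop]; exact sum_nonneg fun k _ => hKL0 k m l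
  have hRA' : ∀ v m, RA 1 v m = ∑ l ∈ range N, KA 1 m l * v (m + 1 + l) := fun v m => by
    rw [hRA]; exact sum_range_of_le hKN fun l hl => by rw [hKA0 1 m l hl, zero_mul]
  have hr0 : 0 < Real.sqrt 2 / 4 := by positivity
  -- the old product over `[l₁, N)` equals the one over `[l₁, K)` (entries vanish beyond `K`)
  have hQ : ∀ m, ∏ i ∈ Ico l₁ N, (1 - Real.sqrt 2 / 4 * KA 1 m i) = ∏ i ∈ Ico l₁ K, (1 - Real.sqrt 2 / 4 * KA 1 m i) := fun m => by
    rw [← prod_Ico_consecutive _ hl₁K hKN, prod_eq_one (s := Ico K N) fun i hi => by rw [hKA0 1 m i (mem_Ico.mp hi).1]; ring, mul_one]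
  refine sol_nonneg_le_of_two_constant_cover (K := KA 1) (R := RA 1) hRA' hKA10 hr0 (fun n l => (hrt n l).le) h01
    (fun n j l hjl _ => aggregate_dominated_undamped hmono hL hb hlo hh hf hg1 hK hKL hKA hKAtop hjl)
    (fun n j l hj hl _ => aggregate_dominated_undamped_ratio hmono hL hb hlo hh hf hg1 hK hKL hKA hKAtop hq0 hq hj hl)
    hc hc0 (fun n => by rw [hQ n]; exact hcrit n) he0 hea hεt hεrec

end Summit.QuantumFields.BalabanUV.Beta.EriceRemainderEnclosureHistoryAutonomyComparisonAgeCompositionGeometricCoverTiersFlow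

end
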